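import Literature.Topology.FourManifolds.ZeroSphereSurgeryModel
import Literature.Topology.FourManifolds.OrientedConnectedSumExistence
import Mathlib.Analysis.Normed.Module.Connected
import HarnessLib

/-!
# The polar parametrisation of the neck of a `0`-surgery by a spherical shell of `ℝ³`

Topic `Literature/Topology/FourManifolds`; elementary maps used to compare the orientation
characters of the two feet of a `0`-surgery along a framed `S⁰` in a `3`-manifold
(`ZeroSphereSurgeryOrientation.lean`; the orientability obstruction of A. A. Kosinski,
*Differential Manifolds* (1993), VI (6.6)).  The new piece `D̊¹ × S²` of the surgery
(`ballTimesSphere Unit 0 2`, `SphereFamilySurgery.lean`) is parametrised by the spherical shell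
`0 < ‖v‖ < 2` of `ℝ³`:

* §1 `neckPolar v = ((), (‖v‖ - 1) e₁, v/‖v‖)` (core sphere `‖v‖ = 1 ↦ 0 × S²`), smooth off the
  origin with injective differential (it has the smooth left inverse
  `neckPolarInv ((), y, u) = (y₀ + 1) u`);
* §2 the shell shift `shellShift v = (1 - ‖v‖⁻¹) v`, which carries the outer shell `1 < ‖v‖ < 2`
  radially onto the punctured unit ball and PRESERVES orientation: its Jacobian determinant is
  `(1 - ‖v‖⁻¹)² > 0` (matrix determinant lemma `det_smul_id_add_smulRight`; compare Kervaire–Milnor's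
  disc inversion `discInversionFun`, which carries the inner punctured ball onto itself and
  REVERSES orientation, `det_fderiv_discInversionFun_neg`);
* §3 spherical shells of `ℝ³` are preconnected.

Everything here is proved; no named facts are introduced.

## References

* A. A. Kosinski, *Differential Manifolds* (1993), VI (6.6). [Kosinski1993]
* M. Kervaire, J. Milnor, *Groups of homotopy spheres I*, Ann. of Math. 77 (1963), §2.
  [KervaireMilnorAnnals1963]
-/

open scoped Manifold ContDiff Topology
open Set Function Filter Module Metric

noncomputable section

namespace Literature.Topology.FourManifolds

/-- Local notation: `𝔼 n` is the model Euclidean space `EuclideanSpace ℝ (Fin n)`. -/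
local notation "𝔼 " n:arg => EuclideanSpace ℝ (Fin n)

/-- Local notation: `𝕊 n` is the unit sphere in `EuclideanSpace ℝ (Fin (n + 1))`. -/
local notation "𝕊 " n:arg => (Metric.sphere (0 : EuclideanSpace ℝ (Fin (n + 1))) 1)

namespace ZeroSphereOrientation

open GluckUnknot (sphereProj coe_sphereProj sphereProj_smul_coe)

attribute [local instance] fact_finrank_euclideanSpace_succ

/-! ### §1 The polar parametrisation of the neck by a spherical shell of `ℝ³` -/

/-- **The polar parametrisation of the neck**: `v ↦ ((), (‖v‖ - 1) e₁, v/‖v‖)`, carrying the shell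
`0 < ‖v‖ < 2` onto `D̊¹ × S²` with the core sphere `‖v‖ = 1` going to `0 × S²`. [folklore] -/
def neckPolar (v : 𝔼 3) : DiscreteIndex Unit × ((𝔼 1) × (𝕊 2)) :=
  (DiscreteIndex.mk (), (‖v‖ - 1) • EuclideanSpace.single 0 1, sphereProj v)

/-- The smooth left inverse `((), y, u) ↦ (y₀ + 1) u` of the polar parametrisation. [folklore] -/
def neckPolarInv (q : DiscreteIndex Unit × ((𝔼 1) × (𝕊 2))) : 𝔼 3 :=
  (q.2.1 0 + 1) • (q.2.2 : 𝔼 3)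

/-- The second component of `neckPolar v` is `(‖v‖ - 1) e₁`. [folklore] -/
@[simp] theorem neckPolar_snd_fst (v : 𝔼 3) :
    (neckPolar v).2.1 = (‖v‖ - 1) • EuclideanSpace.single 0 1 := rfl

/-- The third component of `neckPolar v` is `v/‖v‖`. [folklore] -/
@[simp] theorem neckPolar_snd_snd (v : 𝔼 3) : (neckPolar v).2.2 = sphereProj v := rfl

/-- `‖t e₁‖ = |t|` in `ℝ¹`. [folklore] -/
theorem norm_smul_single (t : ℝ) : ‖t • (EuclideanSpace.single (0 : Fin 1) (1 : ℝ))‖ = |t| := by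
  rw [norm_smul, PiLp.norm_single, norm_one, mul_one, Real.norm_eq_abs]

/-- `((), t e₁, u)` lies in the new piece `D̊¹ × S²` for `|t| < 1`. [folklore] -/
theorem smul_single_mem_ballTimesSphere {t : ℝ} (ht : |t| < 1) (u : 𝕊 2) :
    ((DiscreteIndex.mk (), t • EuclideanSpace.single 0 1, u) :
      DiscreteIndex Unit × ((𝔼 1) × (𝕊 2))) ∈ ballTimesSphere Unit 0 2 := by
  rw [mem_ballTimesSphere_iff]
  show ‖t • (EuclideanSpace.single (0 : Fin 1) (1 : ℝ))‖ < 1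
  rwa [norm_smul_single]

/-- The shell `0 < ‖v‖ < 2` is carried into the new piece. [folklore] -/
theorem neckPolar_mem {v : 𝔼 3} (h0 : 0 < ‖v‖) (h2 : ‖v‖ < 2) :
    neckPolar v ∈ ballTimesSphere Unit 0 2 := by
  refine smul_single_mem_ballTimesSphere ?_ _
  rw [abs_lt]; constructor <;> linarith

/-- `neckPolarInv (neckPolar v) = v` for `v ≠ 0`. [folklore] -/
theorem neckPolarInv_neckPolar {v : 𝔼 3} (hv : v ≠ 0) : neckPolarInv (neckPolar v) = v := by
  simp only [neckPolarInv, neckPolar, PiLp.smul_apply, PiLp.single_apply, if_true,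
    smul_eq_mul, mul_one, sub_add_cancel]
  exact ZeroSphereModel.norm_smul_coe_sphereProj hv

/-- `neckPolarInv` is `C^∞`. [folklore] -/
theorem contMDiff_neckPolarInv :
    ContMDiff ((𝓡 0).prod ((𝓡 1).prod (𝓡 2))) 𝓘(ℝ, 𝔼 3) ∞ neckPolarInv := by
  have h1 : ContMDiff ((𝓡 0).prod ((𝓡 1).prod (𝓡 2))) 𝓘(ℝ, ℝ) ∞
      fun q : DiscreteIndex Unit × ((𝔼 1) × (𝕊 2)) => q.2.1 0 + 1 :=
    (((EuclideanSpace.proj (0 : Fin 1) : 𝔼 1 →L[ℝ] ℝ).contDiff.contMDiff).comp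
      (contMDiff_fst.comp contMDiff_snd)).add contMDiff_const
  exact h1.smul (contMDiff_coe_sphere.comp (contMDiff_snd.comp contMDiff_snd))

/-- `neckPolar` is `C^∞` off the origin. [folklore] -/
theorem contMDiffAt_neckPolar {v : 𝔼 3} (hv : v ≠ 0) :
    ContMDiffAt 𝓘(ℝ, 𝔼 3) ((𝓡 0).prod ((𝓡 1).prod (𝓡 2))) ∞ neckPolar v := by
  have h1 : ContMDiffAt 𝓘(ℝ, 𝔼 3) 𝓘(ℝ, 𝔼 1) ∞
      (fun w : 𝔼 3 => (‖w‖ - 1) • (EuclideanSpace.single (0 : Fin 1) (1 : ℝ))) v :=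
    ((contDiffAt_norm ℝ hv).sub contDiffAt_const).contMDiffAt.smul contMDiffAt_const
  have h2 : ContMDiffAt 𝓘(ℝ, 𝔼 3) (𝓡 2) ∞ sphereProj v :=
    ZeroSphereModel.contMDiffOn_sphereProj.contMDiffAt (isOpen_ne.mem_nhds hv)
  exact contMDiffAt_const.prodMk (h1.prodMk h2)

/-- A continuous linear endomorphism of `ℝ³` with a left inverse... rather: an injective one has
non-vanishing determinant. [folklore] -/
theorem det_ne_zero_of_injective {f : (𝔼 3) →L[ℝ] 𝔼 3} (h : Injective f) :
    LinearMap.det (f : (𝔼 3) →ₗ[ℝ] 𝔼 3) ≠ 0 := by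
  have hunit : IsUnit (f : (𝔼 3) →ₗ[ℝ] 𝔼 3) :=
    (LinearMap.isUnit_iff_ker_eq_bot _).2 (LinearMap.ker_eq_bot.2 h)
  exact ((LinearMap.isUnit_iff_isUnit_det _).1 hunit).ne_zero

/-- **The differential of the polar parametrisation is injective** off the origin (it has the
smooth left inverse `neckPolarInv`). [folklore] -/
theorem injective_mfderiv_neckPolar {v : 𝔼 3} (hv : v ≠ 0) :
    Injective (mfderiv 𝓘(ℝ, 𝔼 3) ((𝓡 0).prod ((𝓡 1).prod (𝓡 2))) neckPolar v) := by
  have hcomp : neckPolarInv ∘ neckPolar =ᶠ[𝓝 v] id := by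
    filter_upwards [isOpen_ne.mem_nhds hv] with w hw
    exact neckPolarInv_neckPolar hw
  have hd : mfderiv 𝓘(ℝ, 𝔼 3) 𝓘(ℝ, 𝔼 3) (neckPolarInv ∘ neckPolar) v =
      ContinuousLinearMap.id ℝ (𝔼 3) := by
    rw [hcomp.mfderiv_eq]
    exact mfderiv_id
  have hL : MDifferentiableAt ((𝓡 0).prod ((𝓡 1).prod (𝓡 2))) 𝓘(ℝ, 𝔼 3) neckPolarInv (neckPolar v) :=
    (contMDiff_neckPolarInv _).mdifferentiableAt (by simp)
  have hβ : MDifferentiableAt 𝓘(ℝ, 𝔼 3) ((𝓡 0).prod ((𝓡 1).prod (𝓡 2))) neckPolar v :=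
    (contMDiffAt_neckPolar hv).mdifferentiableAt (by simp)
  rw [mfderiv_comp v hL hβ] at hd
  intro a b hab
  have ha := ContinuousLinearMap.ext_iff.1 hd a
  have hb := ContinuousLinearMap.ext_iff.1 hd b
  simp only [ContinuousLinearMap.coe_comp, Function.comp_apply] at ha hb
  exact ha.symm.trans ((congrArg _ hab).trans hb)

/-! ### §2 The shell shift `m₊ v = (1 - ‖v‖⁻¹) v` and its Jacobian -/

/-- **The shell shift** `m₊ v = (1 - ‖v‖⁻¹) v = (‖v‖ - 1) v/‖v‖`, carrying the outer shell
`1 < ‖v‖ < 2` radially onto the punctured unit ball. [folklore] -/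
def shellShift (v : 𝔼 3) : 𝔼 3 := (1 - ‖v‖⁻¹) • v

/-- `m₊ v = (‖v‖ - 1) • (v/‖v‖)`. [folklore] -/
theorem shellShift_eq_smul_sphereProj {v : 𝔼 3} (hv : v ≠ 0) :
    shellShift v = (‖v‖ - 1) • (sphereProj v : 𝔼 3) := by
  have hn : ‖v‖ ≠ 0 := norm_ne_zero_iff.2 hv
  rw [shellShift, coe_sphereProj hv, NormedSpace.normalize, smul_smul]
  congr 1
  field_simp

/-- `‖m₊ v‖ = ‖v‖ - 1` for `‖v‖ ≥ 1`. [folklore] -/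
theorem norm_shellShift {v : 𝔼 3} (hv : 1 ≤ ‖v‖) : ‖shellShift v‖ = ‖v‖ - 1 := by
  have hv0 : v ≠ 0 := by rintro rfl; simp at hv; linarith
  rw [shellShift_eq_smul_sphereProj hv0, norm_smul, norm_eq_of_mem_sphere, mul_one,
    Real.norm_of_nonneg (by linarith)]

/-- `m₊ ((1 + ‖w‖) w/‖w‖) = w`: every point of the punctured ball is a shell-shifted point of the
outer shell. [folklore] -/
theorem shellShift_smul {w : 𝔼 3} (hw : w ≠ 0) :
    shellShift (((1 + ‖w‖) * ‖w‖⁻¹) • w) = w := by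
  have hn : 0 < ‖w‖ := norm_pos_iff.2 hw
  have hc : 0 < (1 + ‖w‖) * ‖w‖⁻¹ := mul_pos (by positivity) (inv_pos.2 hn)
  rw [shellShift, norm_smul, Real.norm_of_nonneg hc.le, smul_smul]
  conv_rhs => rw [← one_smul ℝ w]
  congr 1
  field_simp
  ring

/-- **The derivative of the shell shift** at `v ≠ 0` is `(1 - ‖v‖⁻¹) • id + g' ⊗ v` with
`g' v = ‖v‖⁻¹` (matrix-determinant-lemma form). [folklore] -/
theorem exists_hasFDerivAt_shellShift {v : 𝔼 3} (hv : v ≠ 0) :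
    ∃ g' : (𝔼 3) →L[ℝ] ℝ, g' v = ‖v‖⁻¹ ∧
      HasFDerivAt shellShift
        ((1 - ‖v‖⁻¹) • ContinuousLinearMap.id ℝ (𝔼 3) + g'.smulRight v) v := by
  have hN := hasFDerivAt_norm_of_ne_zero hv
  have hn0 : ‖v‖ ≠ 0 := norm_ne_zero_iff.2 hv
  have hinv : HasFDerivAt (fun y : 𝔼 3 => ‖y‖⁻¹)
      ((ContinuousLinearMap.toSpanSingleton ℝ (-(‖v‖ ^ 2)⁻¹)).comp (‖v‖⁻¹ • innerSL ℝ v)) v :=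
    (hasFDerivAt_inv hn0).comp v hN
  have hg := hinv.const_sub 1
  refine ⟨_, ?_, hg.smul (hasFDerivAt_id v)⟩
  simp only [_root_.neg_apply, ContinuousLinearMap.comp_apply,
    ContinuousLinearMap.toSpanSingleton_apply, smul_eq_mul, FunLike.coe_smul,
    Pi.smul_apply, innerSL_apply_apply, real_inner_self_eq_norm_sq]
  field_simp

/-- The shell shift is differentiable off the origin. [folklore] -/
theorem differentiableAt_shellShift {v : 𝔼 3} (hv : v ≠ 0) : DifferentiableAt ℝ shellShift v := by
  obtain ⟨g', -, h⟩ := exists_hasFDerivAt_shellShift hv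
  exact h.differentiableAt

/-- **The shell shift preserves orientation**: its Jacobian determinant at `v`, `‖v‖ ∉ {0, 1}`, is
`(1 - ‖v‖⁻¹)² > 0` (eigenvalue `1` on `ℝ v`, eigenvalue `1 - ‖v‖⁻¹` on `v^⊥`). [folklore] -/
theorem det_fderiv_shellShift_pos {v : 𝔼 3} (hv : v ≠ 0) (hv1 : ‖v‖ ≠ 1) :
    0 < LinearMap.det ((fderiv ℝ shellShift v : (𝔼 3) →L[ℝ] 𝔼 3) : (𝔼 3) →ₗ[ℝ] 𝔼 3) := by
  have hn0 : ‖v‖ ≠ 0 := norm_ne_zero_iff.2 hv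
  obtain ⟨g', hg'v, hd⟩ := exists_hasFDerivAt_shellShift hv
  rw [hd.fderiv]
  set c : ℝ := 1 - ‖v‖⁻¹ with hc_def
  have hc : c ≠ 0 := by
    rw [hc_def]
    intro h
    apply hv1
    field_simp at h
    linarith
  have hcoe : ((c • ContinuousLinearMap.id ℝ (𝔼 3) + g'.smulRight v : (𝔼 3) →L[ℝ] (𝔼 3)) :
      (𝔼 3) →ₗ[ℝ] (𝔼 3)) = c • LinearMap.id + (g' : (𝔼 3) →ₗ[ℝ] ℝ).smulRight v := by
    ext w
    rfl
  rw [hcoe, det_smul_id_add_smulRight (by norm_num) hc]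
  have hg'v' : (g' : (𝔼 3) →ₗ[ℝ] ℝ) v = ‖v‖⁻¹ := hg'v
  have h1 : c + ‖v‖⁻¹ = 1 := by rw [hc_def]; ring
  rw [hg'v', h1, mul_one, show (3 - 1 : ℕ) = 2 from rfl]
  positivity

/-! ### §3 The shell is connected -/

/-- The spherical shell `a < ‖v‖ < b` of `ℝ³` is preconnected (the image of
`(a, b) × S²` under `(r, u) ↦ r u`). [folklore] -/
theorem isPreconnected_shell (a b : ℝ) (ha : 0 ≤ a) :
    IsPreconnected {v : 𝔼 3 | a < ‖v‖ ∧ ‖v‖ < b} := by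
  have hrank : 1 < Module.rank ℝ (𝔼 3) := by
    rw [← Module.finrank_eq_rank, finrank_euclideanSpace_fin]
    norm_num
  have hS : IsPreconnected (Metric.sphere (0 : 𝔼 3) 1) := isPreconnected_sphere hrank 0 1
  have himage : {v : 𝔼 3 | a < ‖v‖ ∧ ‖v‖ < b} =
      (fun p : ℝ × 𝔼 3 => p.1 • p.2) '' (Ioo a b ×ˢ Metric.sphere (0 : 𝔼 3) 1) := by
    ext v
    constructor
    · rintro ⟨hav, hvb⟩
      have hv0 : 0 < ‖v‖ := lt_of_le_of_lt ha hav
      refine ⟨(‖v‖, ‖v‖⁻¹ • v), ⟨⟨hav, hvb⟩, ?_⟩, ?_⟩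
      · rw [mem_sphere_zero_iff_norm, norm_smul, norm_inv, norm_norm, inv_mul_cancel₀ hv0.ne']
      · show ‖v‖ • ‖v‖⁻¹ • v = v
        rw [smul_smul, mul_inv_cancel₀ hv0.ne', one_smul]
    · rintro ⟨⟨r, u⟩, ⟨⟨har, hrb⟩, hu⟩, rfl⟩
      have hr : 0 < r := lt_of_le_of_lt ha har
      show a < ‖r • u‖ ∧ ‖r • u‖ < b
      rw [norm_smul, mem_sphere_zero_iff_norm.1 hu, mul_one, Real.norm_of_nonneg hr.le]
      exact ⟨har, hrb⟩
  rw [himage]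
  exact (isPreconnected_Ioo.prod hS).image _ (continuous_fst.smul continuous_snd).continuousOn

end ZeroSphereOrientation

end Literature.Topology.FourManifolds

end
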